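import Mathlib
import HarnessLib
import Summits.HubbardSuperconductivity.HubbardSuperconductivity.Theorems.KLProgrammeKLRegimeEngineV8TwoLegGridIncrementRep
import Literature.MathematicalPhysics.QuantumLattice.GrassmannSpectatorReadout

/-!
# Route `KLProgramme` — ENGINE child gen 8 (stmt-HubbardSuperconductivity-20437 `KLRegimeEngineV17F2`), class #7 in GRID currency ((Y′)-GRID), deliverable
# W3 «plain-leg m = 2 read-out pass»: the grid increment's plain legs as SPECTATOR legs of a step in the MOMENTUM algebra — the model instance of
# `Literature/…/GrassmannSpectatorReadout` (cell gate-hubbard-kl, seat hubbard-kl-k3c2-p3 g7)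

THE DOOR FOR W3's ANALYTIC HALF.  The grid slice covariance FACTORS through the grid substitution `S := hubbardGridSub L M β N` (`N = 4M`):
`G_{j+1} = Sᵀ · C^K_{(Λ_{j+1},Λ_j]} · S` — verbatim the `M = S`, `C′ = C^K_{(Λ_{j+1},Λ_j]}` case of the spectator read-out.  Hence, for every grid
string `p : Fin m → GridLeg (GridPoint L N)`, each of the three pieces of the grid increment `kernel_m (W_{j+1}[K] − W_j[K]) p`
(`kernel_gridEffAction_succ_sub_eq`, p563490) is the ALL-SPECTATOR kernel `(· ) m Sum.inr` of the same piece of ONE Gaussian step in the enlarged momentum algebra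
`HubbardFieldIdx L M ⊕ Fin m` with the block covariance `fromBlocks C^K_{(Λ_{j+1},Λ_j]} 0 0 0` (the spectators do not fluctuate) acting on the substituted
vertex `Ψ_p W_j[K]`, `Ψ_p : ψ_q ↦ Σ_k S k q ψ̂_k + Σ_{a : p a = q} θ_a`; and the momentum legs of that vertex are those of `𝒱⁽ʲ⁾[K]` itself
(`map (toLin' S) W_j[K] = 𝒱⁽ʲ⁾[K]`, `klEffectiveAction_eq_map_hubbardGridSub`): the vertex is «`𝒱⁽ʲ⁾[K]` with at most `m` legs diverted to the grid pins
`p a`» — the MIXED plain/momentum object whose anchored norms (after the tower's sectorisation of the momentum legs) are the «anchored mixed `hN`» of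
E1's (R59x).  Internal lines join momentum legs only, so the G1-L chain / `sum_[wt_]norm_kernel_effAction_sub_gaussConv_le…` /
`sum_[wt_]norm_kernel_gaussConv_sub_le…` / `sum_[wt_]norm_kernel_grassmannLaplacian_le` apply in the enlarged algebra with the Gram / decay data of the
momentum slice (a zero block changes neither).

* §1 generic: `kernel_map_fromRows_inl` (all-`inl` strings read the `M`-substituted element: `kernel_m (Ψ X) (inl ∘ k) = kernel_m (map (toLin' M) X) k`).
* §2 model: **`kernel_gridEffAction_succ_sub_eq_spectator`** (the three-piece split of p563490 with every piece in spectator form, `m`, `p` arbitrary),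
  `kernel_two_gridEffAction_succ_sub_eq_spectator` (the `m = 2` point-string form the atom reads), **`kernel_gridSpectatorVertex_inl`**
  (`kernel_m (Ψ_p W_j[K]) (inl ∘ k) = kernel_m 𝒱⁽ʲ⁾[K] k`), `kernel_gridSpectatorVertex_inr` (`kernel_m (Ψ_p W_j[K]) (inr ∘ a) = kernel_m W_j[K] (p ∘ a)`),
  `kernel_gridSpectatorVertex_eq_zero_of_repeat` (no kernel carries a grid pin twice).

Exact identities; no estimate, no definition; nothing about the model's sizes is asserted; nothing asserts superconductivity.
References: BGM 2006 §2.2 (2.12), §2.7 (2.70)–(2.71) [cite: BenfattoGiulianiMastropietro2006]; Salmhofer 1999 App. B.2 (B.23)–(B.25), §4.3 (4.95)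
[cite: Salmhofer1999].
-/

noncomputable section

namespace Summit.HubbardSuperconductivity.HubbardSuperconductivity.Theorems.EngineV8

set_option linter.dupNamespace false -- summit = problem name (single-conjunct summit), D-0017

open Real Finset Literature.MathematicalPhysics.QuantumLattice Literature.Probability.LatticeModels
open Literature.Probability.LatticeModels.BattleFederbush GrassmannAlgebra
open Summit.HubbardSuperconductivity.HubbardSuperconductivity.Theorems.KLRegimeSplit
open Summit.HubbardSuperconductivity.HubbardSuperconductivity.Theorems.KLProgrammeLegKernels

/-! ## §1 Generic: all-`inl` strings of the substituted element -/

section Generic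

variable {R : Type*} [CommRing R] [Algebra ℚ R] {Γ Γ' ρ : Type*} [Fintype Γ] [DecidableEq Γ]

/-- **All-`inl` strings read the `M`-substituted element**: `kernel_m (map (toLin' (fromRows M B)) X) (inl ∘ k) = kernel_m (map (toLin' M) X) k`
(the spectator rows are not read). -/
theorem kernel_map_fromRows_inl (M : Matrix Γ' Γ R) (B : Matrix ρ Γ R) (X : GrassmannAlgebra R Γ) (m : ℕ) (k : Fin m → Γ') :
    kernel R (ExteriorAlgebra.map (Matrix.toLin' (Matrix.fromRows M B)) X) m (Sum.inl ∘ k) =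
      kernel R (ExteriorAlgebra.map (Matrix.toLin' M) X) m k := by
  rw [kernel_map_fromRows, kernel_map, LinearMap.toMatrix'_toLin']
  simp only [Function.comp_apply, Matrix.fromRows_apply_inl]

end Generic

/-! ## §2 Model: the grid increment through spectators in the momentum algebra -/

section Model

variable {L M : ℕ} [NeZero L] [NeZero M]

/-- **THE GRID INCREMENT IN SPECTATOR FORM** (`β ≠ 0`, `Z^K_{Λ_j} ≠ 0`; every degree `m`, every grid string `p`): with `S = hubbardGridSub L M β (4M)`,
`C′ = C^K_{(Λ_{j+1},Λ_j]}`, `Ψ_p = map (toLin' (fromRows S [p a = q]))` into the algebra on `HubbardFieldIdx L M ⊕ Fin m` and `B = fromBlocks C′ 0 0 0`,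
`kernel_m (W_{j+1}[K] − W_j[K]) p = kernel_m (Δ_B (Ψ_p W_j)) inr + kernel_m (e^{Δ_B}(Ψ_p W_j) − Ψ_p W_j − Δ_B(Ψ_p W_j)) inr + kernel_m (effAction B (Ψ_p W_j) − e^{Δ_B}(Ψ_p W_j)) inr`. -/
theorem kernel_gridEffAction_succ_sub_eq_spectator {β : ℝ} (hβ : β ≠ 0) (U μ : ℝ) (K : TrigPolyC4v) (j : ℕ)
    (hZ : hubbardEffPartitionFnCT L M β U μ 0 K (klScale klE0 j) ≠ 0) (m : ℕ) (p : Fin m → GridLeg (GridPoint L (2 * (2 * M)))) :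
    kernel ℂ
        (effAction ℂ ((hubbardGridSub L M β (2 * (2 * M))).transpose *
            hubbardCovAboveCT L M β μ 0 K (klScale klE0 (j + 1)) * hubbardGridSub L M β (2 * (2 * M)))
          (hubbardGridInteraction L (2 * (2 * M)) β U + hubbardGridCounterQuadratic L (2 * (2 * M)) β K) -
        effAction ℂ ((hubbardGridSub L M β (2 * (2 * M))).transpose *
            hubbardCovAboveCT L M β μ 0 K (klScale klE0 j) * hubbardGridSub L M β (2 * (2 * M)))
          (hubbardGridInteraction L (2 * (2 * M)) β U + hubbardGridCounterQuadratic L (2 * (2 * M)) β K)) m p =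
      kernel ℂ (grassmannLaplacian ℂ
          (Matrix.fromBlocks (hubbardCovSliceCT L M β μ 0 K (klScale klE0 (j + 1)) (klScale klE0 j)) (0 : Matrix (HubbardFieldIdx L M) (Fin m) ℂ)
            (0 : Matrix (Fin m) (HubbardFieldIdx L M) ℂ) (0 : Matrix (Fin m) (Fin m) ℂ))
          (ExteriorAlgebra.map (Matrix.toLin' (Matrix.fromRows (hubbardGridSub L M β (2 * (2 * M)))
              (Matrix.of fun b q => if p b = q then (1 : ℂ) else 0)))
            (effAction ℂ ((hubbardGridSub L M β (2 * (2 * M))).transpose *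
                hubbardCovAboveCT L M β μ 0 K (klScale klE0 j) * hubbardGridSub L M β (2 * (2 * M)))
              (hubbardGridInteraction L (2 * (2 * M)) β U + hubbardGridCounterQuadratic L (2 * (2 * M)) β K)))) m Sum.inr +
      kernel ℂ (gaussConv ℂ
            (Matrix.fromBlocks (hubbardCovSliceCT L M β μ 0 K (klScale klE0 (j + 1)) (klScale klE0 j)) (0 : Matrix (HubbardFieldIdx L M) (Fin m) ℂ)
              (0 : Matrix (Fin m) (HubbardFieldIdx L M) ℂ) (0 : Matrix (Fin m) (Fin m) ℂ))
            (ExteriorAlgebra.map (Matrix.toLin' (Matrix.fromRows (hubbardGridSub L M β (2 * (2 * M)))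
                (Matrix.of fun b q => if p b = q then (1 : ℂ) else 0)))
              (effAction ℂ ((hubbardGridSub L M β (2 * (2 * M))).transpose *
                  hubbardCovAboveCT L M β μ 0 K (klScale klE0 j) * hubbardGridSub L M β (2 * (2 * M)))
                (hubbardGridInteraction L (2 * (2 * M)) β U + hubbardGridCounterQuadratic L (2 * (2 * M)) β K))) -
          ExteriorAlgebra.map (Matrix.toLin' (Matrix.fromRows (hubbardGridSub L M β (2 * (2 * M)))
              (Matrix.of fun b q => if p b = q then (1 : ℂ) else 0)))
            (effAction ℂ ((hubbardGridSub L M β (2 * (2 * M))).transpose *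
                hubbardCovAboveCT L M β μ 0 K (klScale klE0 j) * hubbardGridSub L M β (2 * (2 * M)))
              (hubbardGridInteraction L (2 * (2 * M)) β U + hubbardGridCounterQuadratic L (2 * (2 * M)) β K)) -
          grassmannLaplacian ℂ
            (Matrix.fromBlocks (hubbardCovSliceCT L M β μ 0 K (klScale klE0 (j + 1)) (klScale klE0 j)) (0 : Matrix (HubbardFieldIdx L M) (Fin m) ℂ)
              (0 : Matrix (Fin m) (HubbardFieldIdx L M) ℂ) (0 : Matrix (Fin m) (Fin m) ℂ))
            (ExteriorAlgebra.map (Matrix.toLin' (Matrix.fromRows (hubbardGridSub L M β (2 * (2 * M)))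
                (Matrix.of fun b q => if p b = q then (1 : ℂ) else 0)))
              (effAction ℂ ((hubbardGridSub L M β (2 * (2 * M))).transpose *
                  hubbardCovAboveCT L M β μ 0 K (klScale klE0 j) * hubbardGridSub L M β (2 * (2 * M)))
                (hubbardGridInteraction L (2 * (2 * M)) β U + hubbardGridCounterQuadratic L (2 * (2 * M)) β K)))) m Sum.inr +
      kernel ℂ (effAction ℂ
            (Matrix.fromBlocks (hubbardCovSliceCT L M β μ 0 K (klScale klE0 (j + 1)) (klScale klE0 j)) (0 : Matrix (HubbardFieldIdx L M) (Fin m) ℂ)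
              (0 : Matrix (Fin m) (HubbardFieldIdx L M) ℂ) (0 : Matrix (Fin m) (Fin m) ℂ))
            (ExteriorAlgebra.map (Matrix.toLin' (Matrix.fromRows (hubbardGridSub L M β (2 * (2 * M)))
                (Matrix.of fun b q => if p b = q then (1 : ℂ) else 0)))
              (effAction ℂ ((hubbardGridSub L M β (2 * (2 * M))).transpose *
                  hubbardCovAboveCT L M β μ 0 K (klScale klE0 j) * hubbardGridSub L M β (2 * (2 * M)))
                (hubbardGridInteraction L (2 * (2 * M)) β U + hubbardGridCounterQuadratic L (2 * (2 * M)) β K))) -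
          gaussConv ℂ
            (Matrix.fromBlocks (hubbardCovSliceCT L M β μ 0 K (klScale klE0 (j + 1)) (klScale klE0 j)) (0 : Matrix (HubbardFieldIdx L M) (Fin m) ℂ)
              (0 : Matrix (Fin m) (HubbardFieldIdx L M) ℂ) (0 : Matrix (Fin m) (Fin m) ℂ))
            (ExteriorAlgebra.map (Matrix.toLin' (Matrix.fromRows (hubbardGridSub L M β (2 * (2 * M)))
                (Matrix.of fun b q => if p b = q then (1 : ℂ) else 0)))
              (effAction ℂ ((hubbardGridSub L M β (2 * (2 * M))).transpose *
                  hubbardCovAboveCT L M β μ 0 K (klScale klE0 j) * hubbardGridSub L M β (2 * (2 * M)))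
                (hubbardGridInteraction L (2 * (2 * M)) β U + hubbardGridCounterQuadratic L (2 * (2 * M)) β K)))) m Sum.inr := by
  have h1 := kernel_grassmannLaplacian_eq_spectator ℂ (hubbardGridSub L M β (2 * (2 * M)))
    (hubbardCovSliceCT L M β μ 0 K (klScale klE0 (j + 1)) (klScale klE0 j)) p
    (effAction ℂ ((hubbardGridSub L M β (2 * (2 * M))).transpose *
        hubbardCovAboveCT L M β μ 0 K (klScale klE0 j) * hubbardGridSub L M β (2 * (2 * M)))
      (hubbardGridInteraction L (2 * (2 * M)) β U + hubbardGridCounterQuadratic L (2 * (2 * M)) β K)) m id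
  have h2 := kernel_gaussConv_sub_sub_laplacian_eq_spectator ℂ (hubbardGridSub L M β (2 * (2 * M)))
    (hubbardCovSliceCT L M β μ 0 K (klScale klE0 (j + 1)) (klScale klE0 j)) p
    (effAction ℂ ((hubbardGridSub L M β (2 * (2 * M))).transpose *
        hubbardCovAboveCT L M β μ 0 K (klScale klE0 j) * hubbardGridSub L M β (2 * (2 * M)))
      (hubbardGridInteraction L (2 * (2 * M)) β U + hubbardGridCounterQuadratic L (2 * (2 * M)) β K)) m id
  have h3 := kernel_effAction_sub_gaussConv_eq_spectator ℂ (hubbardGridSub L M β (2 * (2 * M)))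
    (hubbardCovSliceCT L M β μ 0 K (klScale klE0 (j + 1)) (klScale klE0 j)) p
    (effAction ℂ ((hubbardGridSub L M β (2 * (2 * M))).transpose *
        hubbardCovAboveCT L M β μ 0 K (klScale klE0 j) * hubbardGridSub L M β (2 * (2 * M)))
      (hubbardGridInteraction L (2 * (2 * M)) β U + hubbardGridCounterQuadratic L (2 * (2 * M)) β K)) m id
  rw [Function.comp_id, Function.comp_id] at h1 h2 h3
  rw [kernel_gridEffAction_succ_sub_eq hβ U μ K j hZ m p, h1, h2, h3]

/-- **THE MOMENTUM LEGS OF THE SPECTATOR VERTEX ARE THOSE OF `𝒱⁽ʲ⁾[K]`** (`β ≠ 0`): for every `m`, every grid pin family `p` and every momentum string `k`,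
`kernel_m (Ψ_p W_j[K]) (inl ∘ k) = kernel_m (klEffectiveAction L M β U μ K klE0 j) k` (`map (toLin' S) W_j[K] = 𝒱⁽ʲ⁾[K]`). -/
theorem kernel_gridSpectatorVertex_inl {β : ℝ} (hβ : β ≠ 0) (U μ : ℝ) (K : TrigPolyC4v) (j : ℕ) {r : ℕ}
    (p : Fin r → GridLeg (GridPoint L (2 * (2 * M)))) (m : ℕ) (k : Fin m → HubbardFieldIdx L M) :
    kernel ℂ (ExteriorAlgebra.map (Matrix.toLin' (Matrix.fromRows (hubbardGridSub L M β (2 * (2 * M)))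
          (Matrix.of fun b q => if p b = q then (1 : ℂ) else 0)))
        (effAction ℂ ((hubbardGridSub L M β (2 * (2 * M))).transpose *
            hubbardCovAboveCT L M β μ 0 K (klScale klE0 j) * hubbardGridSub L M β (2 * (2 * M)))
          (hubbardGridInteraction L (2 * (2 * M)) β U + hubbardGridCounterQuadratic L (2 * (2 * M)) β K))) m (Sum.inl ∘ k) =
      kernel ℂ (klEffectiveAction L M β U μ K klE0 j) m k := by
  haveI : NeZero (2 * (2 * M) : ℕ) := ⟨by have := NeZero.ne M; omega⟩
  rw [kernel_map_fromRows_inl, ← klEffectiveAction_eq_map_hubbardGridSub hβ U μ K klE0 j (by omega) (by omega)]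

omit [NeZero M] in
/-- **The spectator legs of the spectator vertex are the grid legs of `W_j[K]`**: `kernel_m (Ψ_p W_j[K]) (inr ∘ a) = kernel_m (W_j[K]) (p ∘ a)`. -/
theorem kernel_gridSpectatorVertex_inr (β U μ : ℝ) (K : TrigPolyC4v) (j : ℕ) {r : ℕ} (p : Fin r → GridLeg (GridPoint L (2 * (2 * M)))) (m : ℕ)
    (a : Fin m → Fin r) :
    kernel ℂ (ExteriorAlgebra.map (Matrix.toLin' (Matrix.fromRows (hubbardGridSub L M β (2 * (2 * M)))
          (Matrix.of fun b q => if p b = q then (1 : ℂ) else 0)))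
        (effAction ℂ ((hubbardGridSub L M β (2 * (2 * M))).transpose *
            hubbardCovAboveCT L M β μ 0 K (klScale klE0 j) * hubbardGridSub L M β (2 * (2 * M)))
          (hubbardGridInteraction L (2 * (2 * M)) β U + hubbardGridCounterQuadratic L (2 * (2 * M)) β K))) m (Sum.inr ∘ a) =
      kernel ℂ (effAction ℂ ((hubbardGridSub L M β (2 * (2 * M))).transpose *
            hubbardCovAboveCT L M β μ 0 K (klScale klE0 j) * hubbardGridSub L M β (2 * (2 * M)))
          (hubbardGridInteraction L (2 * (2 * M)) β U + hubbardGridCounterQuadratic L (2 * (2 * M)) β K)) m (p ∘ a) :=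
  kernel_map_fromRows_spectator_inr ℂ _ p _ m a

omit [NeZero M] in
/-- **No kernel of the spectator vertex carries a grid pin twice** (`θ_a² = 0`): if `Z i = inr b = Z i'` with `i ≠ i'`, the kernel vanishes — with `r = 2`
pins at most two plain grid legs occur in any kernel of `Ψ_p W_j[K]`. -/
theorem kernel_gridSpectatorVertex_eq_zero_of_repeat (β U μ : ℝ) (K : TrigPolyC4v) (j : ℕ) {r : ℕ} (p : Fin r → GridLeg (GridPoint L (2 * (2 * M))))
    (m : ℕ) (Z : Fin m → HubbardFieldIdx L M ⊕ Fin r) {i i' : Fin m} (hii' : i ≠ i') {b : Fin r} (hi : Z i = Sum.inr b) (hi' : Z i' = Sum.inr b) :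
    kernel ℂ (ExteriorAlgebra.map (Matrix.toLin' (Matrix.fromRows (hubbardGridSub L M β (2 * (2 * M)))
          (Matrix.of fun b q => if p b = q then (1 : ℂ) else 0)))
        (effAction ℂ ((hubbardGridSub L M β (2 * (2 * M))).transpose *
            hubbardCovAboveCT L M β μ 0 K (klScale klE0 j) * hubbardGridSub L M β (2 * (2 * M)))
          (hubbardGridInteraction L (2 * (2 * M)) β U + hubbardGridCounterQuadratic L (2 * (2 * M)) β K))) m Z = 0 :=
  kernel_map_fromRows_eq_zero_of_spectator_repeat ℂ _ p _ m Z hii' hi hi'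

end Model

end Summit.HubbardSuperconductivity.HubbardSuperconductivity.Theorems.EngineV8

end
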